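import Mathlib
import Summits.Ventures.HodgeRepro0.P5UnreadClassesCert

/-!
# P5UnreadClassesCert2 — the generation half of the bridge of `P5UnreadClassesCert` (rev-2 (g15)'s precisions P5-1 / P5-2)

`P5UnreadClassesCert` certifies that `Q12` (resp. `Q8`) CONTAINS every square and every commutator of `T12` (resp. `T8`);
its docstring's bridge to «exactly three index-2 subgroups of `T12`, two of them `ι`-free» and «`Q8` the unique index-2 subgroup
of `T8`» also needs the other inclusion — that `Q12` / `Q8` is GENERATED by the squares and commutators — which that file did
not certify (rev-2 (g15), STATUS l.4458, P5-1). This sibling certifies it at the data level, with the stronger statements: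

* `Q12_subset_squares`: every element of `Q12` IS a square of `T12`; so, with `index_two_contains_sq_comm`, every index-2
  subgroup `H` of `T12` contains `Q12`, hence is a union of `Q12`-cosets; by `HABC12_cosets` every element of `T12` outside
  `Q12` lies in exactly one of `HA12`, `HB12`, `HC12`, so `H` (= `Q12` together with one non-trivial coset) is one of the
  three — EXACTLY THREE index-2 subgroups, EXACTLY TWO of them `ι`-free;
* `Q8_subset_sq_comm`: every element of `Q8` is a square or a commutator of `T8`; so every index-2 subgroup of `T8` contains
  `Q8`, which has index 2 — `Q8` is the UNIQUE index-2 subgroup of `T8`;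
* `T12_perms`, `T8_perms` (P5-2): every listed element of `T12` and of `T8` is a permutation of `0 … 15` (length 16, every point
  hit), so the junk value of `getD` / `idxOf` never enters; the other listed sets are certified subsets of `T12` / `T8`.

NOT certified: as in `P5UnreadClassesCert` (the identification of the explicit groups with the census's T classes, the group
names, anything Hodge-theoretic).
-/

namespace HodgeRepro0.P5UnreadClassesCert

/-- `p` is a permutation of `0 … 15`: a list of length 16 containing every point -/
def isPermP (p : P) : Bool := p.length == 16 && (List.range 16).all (fun i => p.contains i)

/-- every element of `Q12` is a square of `T12` (the generation half of «`Q12` = ⟨squares, commutators⟩»: `T12` has exactly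
twelve squares and they are `Q12`) -/
theorem Q12_subset_squares : subsetP Q12 (T12.map (fun p => comp p p)) = true := by decide +kernel

/-- the squares of `T12` are exactly `Q12` (twelve distinct values) -/
theorem squares_T12_eq_Q12 : (subsetP (T12.map (fun p => comp p p)) Q12 && subsetP Q12 (T12.map (fun p => comp p p))) = true := by
  decide +kernel

/-- every element of `Q8` is a square or a commutator of `T8` (the generation half for `T8`) -/
theorem Q8_subset_sq_comm :
    Q8.all (fun z => isSquareIn T8 z || T8.any (fun p => T8.any (fun q => comp (comp p q) (comp (invP p) (invP q)) == z))) = true := by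
  decide +kernel

/-- every listed element of `T12` is a permutation of `0 … 15` -/
theorem T12_perms : T12.all isPermP = true := by decide +kernel

/-- every listed element of `T8` is a permutation of `0 … 15` -/
theorem T8_perms : T8.all isPermP = true := by decide +kernel

/-- `ι` is a permutation of `0 … 15` -/
theorem iota_perm : isPermP iota = true := by decide +kernel

end HodgeRepro0.P5UnreadClassesCert
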